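/-
Copyright: the b2b-balaban T⁴-continuum CRUX team, row NE7b leaf lineage `t4-ne7b-formalise-leaf-05` (gen 153). Project licence.
-/
import Literature.MathematicalPhysics.QuantumFieldTheory.Balaban1983to89.B9SectEKernel
import Literature.MathematicalPhysics.QuantumFieldTheory.Balaban1983to89.B6Lemma24Assembly

/-!
# THE (h2) SLOT OF PRINT's `γ₀` ASSEMBLY, PROVED AS A SKELETON: «covariant Lemma 2.4′» by IMS localisation — the floor
# `c_V‖B‖² ≤ F(B)` on the admissible subspace of [B9] (3.156) from (i) a FLAT floor per cube (B6 Lemma 2.4, PROVED in the tree,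
# consumed BY VALUE: `c = κ₀(d,L)∕(12d²)·L^{−(d+1)}`), (ii) a square-root-form perturbation letter `δ`, (iii) a gauge transport per cube,
# (iv) the IMS error letter `ε` — `c_V = c∕2 − δ − ε∕2`; then `B9SectEKernel.gamma0_assembly` BY NAME with (h2) SUPPLIED, and Theorem E1's
# arithmetic `γ₀′ ≥ c∕640` (row NE7b, node U5c; residual (R2′) family (2), letter (ℓ1) in B9 Sect. E's matrix currency; kernel lemmas + junctions)

Cell `pub-balaban`, sub-cell `t4`, spine estimate NE7b (`T4WeightBudget.RelWeightBound`; the cell's OWN estimate — NOT PRINTED in [Bałaban 1983–89],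
NOT PROVED).  Crux-route work under `Spine/NE7b/`; NOTHING of Bałaban's is asserted; no `def`; zero `sorry`; no `T4Continuum/Support` leaf (FREEZE (0)).
Imports (both with hub oleans): the reader cell's `….Balaban1983to89.B9SectEKernel` (r1; `gamma0_assembly`, `ims_lower`, `coercive_sandwich_of_range`,
`QGQInverse.Coercive`) and `….B6Lemma24Assembly` (pv09∕b06; `lemma24_kappa0` — [B6] CMP **96** (1984) Lemma 2.4 (2.128) p. 245 with the repaired layer
constant `κ₀`, PROVED).

WHY.  `…CoerciveFluctuationFloor` §5 (leaf-05 g151) reads print's p. 428 sentence «`C*Δ_kC` … positive definite with a lower bound `γ₀ > 0` independent of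
`k` and `U` … Localizing the operators in `Δ_k` …» into the road's Hessian floor through `B9SectEKernel.gamma0_assembly`, whose three analytic inputs (h1),
(h2), (hJ) stay DISPLAYED (GAPS G-B9-09: «asserted, proved nowhere in print»; written repair `HOME/b2b-balaban-r1/SectE-interface-proof.md` §5, whose
census §8.5 lists Lemma 5.5 ∕ Prop. 5.6 — the (h2) proof — as NOT kernel-checked).  THIS FILE kernel-checks the finite-dimensional skeleton of exactly
that (h2) proof (§5.5 Lemma 5.5 «local step»: gauge covariance + `(x − y)² ≥ ½x² − y²` + flat Lemma 2.4; §5.6 Prop. 5.6: `ims_lower` cube by cube),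
and plugs the tree's PROVED flat Lemma 2.4 into its flat slot BY VALUE.  After it, (h2) ⇐ three DISPLAYED letters only: the perturbation size `δ`
(`= c₄²ε_F²`, (π8)), the local small gauges `u_s` with their covariance identity ((π4), reading R-V), the IMS Schur letter `ε` (`= ε_IMS(M)`).

WHAT IS PROVED ([folklore]; real index types `m` (unit-lattice bonds × colour), `ι` (cubes); `x ⬝ᵥ x = ‖x‖²`; `good` = the admissible subspace):
* §1 SQUARE-ROOT-FORM PERTURBATION (Lemma 5.5's inequality `y²∕2 − (x−y)² ≤ x²`, summed): `sum_sq_ge_half_sub`,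
  **`floor_of_sqrt_perturbation`** (`c‖B‖² ≤ Σ_p g_p(B)²`, `Σ_p (f_p(B) − g_p(B))² ≤ δ‖B‖²` ⊢ `(c∕2 − δ)‖B‖² ≤ Σ_p f_p(B)²`), `floor_of_half_sub` (letter form).
* §2 GAUGE TRANSPORT: **`floor_transport`** (`‖uX‖² = ‖X‖²`, `F X = F′(uX)`, `good X → good′(uX)`, floor `c` for `F′` on `good′` ⊢ floor `c` for `F` on
  `good`), **`local_floor`** (= Lemma 5.5's shape: transport ∘ perturbation ∘ flat floor ⊢ `(c∕2 − δ)‖X‖² ≤ F X`).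
* §3 IMS ASSEMBLY (Prop. 5.6's shape): `sum_dotProduct_localised` (`Σ_s ‖h_s·x‖² = ‖x‖²` for a quadratic partition of unity),
  **`floor_of_ims`** (`B9SectEKernel.ims_lower` BY NAME + local floors `c_loc‖h_s·x‖² ≤ ⟨h_s·x, K_F(h_s·x)⟩` on `good` ⊢ `(c_loc − ε∕2)‖x‖² ≤ ⟨x, K_F x⟩`).
* §4 **`admissible_floor`** — THE (h2) SLOT IN ITS BINDER SHAPE: per-cube gauges `u_s`, gauged forms `F′_s`, flat forms `F⁰_s` with the five letters
  (cov) `⟨h_s·x, K_F(h_s·x)⟩ = F′_s(u_s(h_s·x))`, (iso), (adm) `good x → good⁰_s(u_s(h_s·x))`, (pert) `F⁰_s Y∕2 − δ‖Y‖² ≤ F′_s Y`, (flat) `c‖Y‖² ≤ F⁰_s Y`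
  on `good⁰_s`, plus `⟨x, K_F x⟩ ≤ F x` on `good` ⊢ `∀ x, good x → (c∕2 − δ − ε∕2)·(x ⬝ᵥ x) ≤ F x` — VERBATIM the `h2` hypothesis of `gamma0_assembly`.
* §5 **`gamma0_assembly_of_ims`** — `gamma0_assembly` BY NAME with (h2) := §4: `((c∕2 − δ − ε∕2 − κ₂)∕κ₁ − θ)‖B‖² ≤ ⟨B, (P − a − 𝒥)B⟩` on `good`;
  **`coercive_sandwich_of_ims`** — then `coercive_sandwich_of_range` BY NAME: `QGQInverse.Coercive (Cᵀ(P − a − 𝒥)C) ((c∕2 − δ − ε∕2 − κ₂)∕κ₁ − θ)`.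
* §6 THEOREM E1's ARITHMETIC: **`gamma0_value_ge`** (`0 ≤ c`, `0 < κ₁ ≤ 40`, `κ₂, δ ≤ c∕8`, `ε ≤ c∕4`, `θ ≤ c∕640` ⊢ `c∕640 ≤ (c∕2 − δ − ε∕2 − κ₂)∕κ₁ − θ`),
  **`coercive_sandwich_of_ims_value`** (`Coercive (Cᵀ(P − a − 𝒥)C) (c∕640)`).
* §7 THE FLAT SLOT BY VALUE: **`flat_floor_lemma24`** — for real unit-lattice bond fields indexed by `lamBonds L Λ′` (Λ = B(Λ′), Λ′ ⊂ LZ^d, d ≥ 2, L ≥ 1)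
  in the tree gauge (2.121): `κ₀(d,L)∕(12d²)·L^{−(d+1)}·(Y ⬝ᵥ Y) ≤ L^{d−2}·q1Of(Ỹ) + d1Sq(Ỹ)` (`Ỹ` = `Y` extended by `0`) — `B6Lemma24Assembly.lemma24_kappa0`
  BY NAME; **`floor_of_components`** — colour components add (a floor with one `c` per component is a floor for the `m × κ`-indexed field).
* §8 toy: one cube, `h ≡ 1`, `u = id`, `K_F = 1`, `δ = ε = 0` — §4 yields `½‖x‖² ≤ ‖x‖²` (the structural `½` of Lemma 5.5 is the only loss) (`example`).

NOT HERE (honest): the three letters `δ, u_s ∕ (cov), ε` BY VALUE ((π8) B7 Props 1–2 (124)∕(126); (π4) + R-V local axial gauges on doubled M-cubes from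
(3.35); `ε_IMS ≤ C_F 2^d c_h²(L+1)²∕M²` from the range and coefficients of `K_F`); (h1), (hJ) and the two invertibility letters behind `(H, P)` (CFF §5
`hessian_lower_of_deltaK`); WHICH `K_F, good, F` print's step displays ((A3) ∕ (A1c), NC-NE7b-α UNRULED); the identification of B6's `q1Of` with B5 (1.8)'s
`Q₁` under (2.121) (B6Lemma24Carrier's declared scope (i) carries over).  BY-NAME EFFECT ON THE WALL: NONE ((ℓ1)'s Sect. E supplier loses one displayed
input: (h2) ⇐ PROVED flat Lemma 2.4 + three letters; the wall is (R2)).  NE7b NOT PRINTED ∕ NOT PROVED; spine PROVED 0∕9; rung (B)+1 on ONE finite T⁴ —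
NOT infinite volume, NOT the mass gap, NOT Clay.
HONEST DEPENDENCY: continuum YM on T⁴ ⇐ BetaPertH ∧ nine spine estimates (0/9 proved); BetaPertH ⇐ (D1) ∧ (D4) ∧ CAP+tail; G-an2-4 gates asym, D1 and NE2/3/4.
-/

set_option autoImplicit false

noncomputable section

open Matrix Finset
open Literature.MathematicalPhysics.QuantumFieldTheory.Balaban1983to89 (QGQInverse.Coercive)
open Literature.MathematicalPhysics.QuantumFieldTheory.Balaban1983to89.B9SectEKernel
  (imsError ims_localization ims_lower gamma0_assembly coercive_sandwich_of_range)

namespace Summit.QuantumFields.BalabanUV.T4Continuum.NE7b.AdmissibleFloorIMS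

/-! ## §1 Square-root-form perturbation: `(x − y)² ≥ ½x² − y²` (Lemma 5.5's inequality) -/

section Perturbation

variable {m : Type*} [Fintype m]

/-- Summed square-root-form inequality: `(Σ_p g_p²)∕2 − Σ_p (f_p − g_p)² ≤ Σ_p f_p²` for any finite family — termwise
`y²∕2 − (x − y)² ≤ x²` (`2x² − 2xy + y²∕2 = ½(2x − y)² ≥ 0`; the pointwise inequality is the tree's
`Literature.MathematicalPhysics.KineticTheory.HeatConduction.sq_ge_half_sq_sub`, re-derived inline by `nlinarith` rather than imported across cells). [folklore] -/
theorem sum_sq_ge_half_sub {ι : Type*} (s : Finset ι) (f g : ι → ℝ) :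
    (∑ p ∈ s, g p ^ 2) / 2 - ∑ p ∈ s, (f p - g p) ^ 2 ≤ ∑ p ∈ s, f p ^ 2 := by
  rw [Finset.sum_div, ← Finset.sum_sub_distrib]
  exact Finset.sum_le_sum fun p _ => by nlinarith [sq_nonneg (2 * f p - g p)]

/-- **FLOOR UNDER A SQUARE-ROOT-FORM PERTURBATION** (Lemma 5.5's analytic step): two sums of squares of functionals, `Σ_p g_p(B)²` with the floor
`c‖B‖²` and `Σ_p f_p(B)²` whose «square root» differs by `Σ_p (f_p(B) − g_p(B))² ≤ δ‖B‖²`; then `(c∕2 − δ)‖B‖² ≤ Σ_p f_p(B)²`.  In print's use: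
`g_p = (∂₁B″)(p)` (flat curl), `f_p = (∂_{e^{iW}}B″)(p)` (curl at a small gauge field), `δ = c₄²ε_F²`. [folklore] -/
theorem floor_of_sqrt_perturbation {ι : Type*} (s : Finset ι) (f g : ι → (m → ℝ) → ℝ) {c δ : ℝ} (B : m → ℝ)
    (hg : c * (B ⬝ᵥ B) ≤ ∑ p ∈ s, g p B ^ 2) (hfg : ∑ p ∈ s, (f p B - g p B) ^ 2 ≤ δ * (B ⬝ᵥ B)) :
    (c / 2 - δ) * (B ⬝ᵥ B) ≤ ∑ p ∈ s, f p B ^ 2 := by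
  have h := sum_sq_ge_half_sub s (fun p => f p B) (fun p => g p B)
  linarith

/-- Letter form of the same step: a flat floor `c‖Y‖² ≤ F⁰ Y` on `good⁰` and a perturbation letter `F⁰ Y∕2 − δ‖Y‖² ≤ F′ Y` on `good⁰` give the floor
`(c∕2 − δ)‖Y‖² ≤ F′ Y` on `good⁰`. [folklore] -/
theorem floor_of_half_sub (F0 F' : (m → ℝ) → ℝ) (good0 : (m → ℝ) → Prop) {c δ : ℝ}
    (hflat : ∀ Y, good0 Y → c * (Y ⬝ᵥ Y) ≤ F0 Y) (hpert : ∀ Y, good0 Y → F0 Y / 2 - δ * (Y ⬝ᵥ Y) ≤ F' Y)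
    (Y : m → ℝ) (hY : good0 Y) : (c / 2 - δ) * (Y ⬝ᵥ Y) ≤ F' Y := by
  have h1 := hflat Y hY
  have h2 := hpert Y hY
  linarith

end Perturbation

/-! ## §2 Gauge transport: a floor is invariant under an isometric change of variables that carries the form (Lemma 5.5's first step) -/

section Transport

variable {m m' : Type*} [Fintype m] [Fintype m']

/-- **FLOOR TRANSPORT ALONG A GAUGE**: `u` an isometry for `⬝ᵥ` (`|·|` is `Ad`-invariant), `F X = F′(uX)` on `good` (summand-wise gauge covariance of
the form: `(∂_{V^u}B^u)(P) = Ad(u(y_P))(∂_V B)(P)`, `(Q₁(V^u)B^u)(c) = Ad(u(c₋))(Q₁(V)B)(c)`), `good X → good′(uX)` (the gauged field is axial and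
supported where `X` is); a floor `c` for `F′` on `good′` is a floor `c` for `F` on `good`. [folklore] -/
theorem floor_transport (F : (m → ℝ) → ℝ) (F' : (m' → ℝ) → ℝ) (u : (m → ℝ) → (m' → ℝ))
    (good : (m → ℝ) → Prop) (good' : (m' → ℝ) → Prop) {c : ℝ}
    (hiso : ∀ X, good X → u X ⬝ᵥ u X = X ⬝ᵥ X) (hcov : ∀ X, good X → F X = F' (u X))
    (hadm : ∀ X, good X → good' (u X)) (hfloor : ∀ Y, good' Y → c * (Y ⬝ᵥ Y) ≤ F' Y)
    (X : m → ℝ) (hX : good X) : c * (X ⬝ᵥ X) ≤ F X := by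
  rw [hcov X hX, ← hiso X hX]
  exact hfloor (u X) (hadm X hX)

/-- **THE LOCAL STEP (Lemma 5.5's shape)**: gauge transport ∘ square-root-form perturbation ∘ flat floor.  `u` isometric and admissibility-preserving,
`F X = F′(uX)` on `good`; on `good⁰`: `c‖Y‖² ≤ F⁰ Y` (flat Lemma 2.4) and `F⁰ Y∕2 − δ‖Y‖² ≤ F′ Y` (the small-gauge-field form against the flat one);
then `(c∕2 − δ)‖X‖² ≤ F X` on `good`. [folklore] -/
theorem local_floor (F : (m → ℝ) → ℝ) (F' F0 : (m' → ℝ) → ℝ) (u : (m → ℝ) → (m' → ℝ))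
    (good : (m → ℝ) → Prop) (good0 : (m' → ℝ) → Prop) {c δ : ℝ}
    (hiso : ∀ X, good X → u X ⬝ᵥ u X = X ⬝ᵥ X) (hcov : ∀ X, good X → F X = F' (u X))
    (hadm : ∀ X, good X → good0 (u X))
    (hpert : ∀ Y, good0 Y → F0 Y / 2 - δ * (Y ⬝ᵥ Y) ≤ F' Y) (hflat : ∀ Y, good0 Y → c * (Y ⬝ᵥ Y) ≤ F0 Y)
    (X : m → ℝ) (hX : good X) : (c / 2 - δ) * (X ⬝ᵥ X) ≤ F X :=
  floor_transport F F' u good good0 hiso hcov hadm (floor_of_half_sub F0 F' good0 hflat hpert) X hX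

end Transport

/-! ## §3 IMS assembly: local floors on the localised fields `h_s·x` ⟹ a global floor, at the price `ε∕2` (Prop. 5.6's shape) -/

section IMS

variable {m : Type*} [Fintype m] {ι : Type*} [Fintype ι]

/-- A quadratic partition of unity `Σ_s h_s(i)² = 1` splits the norm: `Σ_s ‖h_s·x‖² = ‖x‖²`. [folklore] -/
theorem sum_dotProduct_localised (h : ι → m → ℝ) (hpart : ∀ i, ∑ s, h s i ^ 2 = 1) (x : m → ℝ) :
    ∑ s, (h s * x) ⬝ᵥ (h s * x) = x ⬝ᵥ x := by
  simp only [dotProduct, Pi.mul_apply]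
  rw [Finset.sum_comm]
  refine Finset.sum_congr rfl fun i _ => ?_
  have e : ∀ s, h s i * x i * (h s i * x i) = h s i ^ 2 * (x i * x i) := fun s => by ring
  simp_rw [e]
  rw [← Finset.sum_mul, hpart i, one_mul]

/-- **THE IMS ASSEMBLY OF A FLOOR** (`B9SectEKernel.ims_lower` BY NAME): `K_F` any real matrix (the matrix of the full form `F_V^{full}`), `{h_s}` a
quadratic partition of unity whose localisation error passes the Schur test with `ε` (`Σ_j |K_F(i,j)| Σ_s (h_s(i) − h_s(j))² ≤ ε`, rows and columns), and
LOCAL floors `c_loc‖h_s·x‖² ≤ ⟨h_s·x, K_F(h_s·x)⟩` for every cube `s` and every admissible `x`; then `(c_loc − ε∕2)‖x‖² ≤ ⟨x, K_F x⟩` for every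
admissible `x`. [folklore] -/
theorem floor_of_ims (KF : Matrix m m ℝ) (h : ι → m → ℝ) (hpart : ∀ i, ∑ s, h s i ^ 2 = 1) {ε cloc : ℝ} (hε : 0 ≤ ε)
    (hrow : ∀ i, ∑ j, |KF i j| * ∑ s, (h s i - h s j) ^ 2 ≤ ε)
    (hcol : ∀ j, ∑ i, |KF i j| * ∑ s, (h s i - h s j) ^ 2 ≤ ε)
    (good : (m → ℝ) → Prop)
    (hloc : ∀ s x, good x → cloc * ((h s * x) ⬝ᵥ (h s * x)) ≤ (h s * x) ⬝ᵥ (KF *ᵥ (h s * x)))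
    (x : m → ℝ) (hx : good x) : (cloc - ε / 2) * (x ⬝ᵥ x) ≤ x ⬝ᵥ (KF *ᵥ x) := by
  have hims := ims_lower KF h hpart hε hrow hcol x
  have hsum : cloc * (x ⬝ᵥ x) ≤ ∑ s, (h s * x) ⬝ᵥ (KF *ᵥ (h s * x)) := by
    rw [← sum_dotProduct_localised h hpart x, Finset.mul_sum]
    exact Finset.sum_le_sum fun s _ => hloc s x hx
  linarith

end IMS

/-! ## §4 The (h2) slot in its binder shape (Prop. 5.6 ∘ Lemma 5.5) -/

section Admissible

variable {m m' : Type*} [Fintype m] [Fintype m'] {ι : Type*} [Fintype ι]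

/-- **COVARIANT LEMMA 2.4′ — THE (h2) SLOT OF `gamma0_assembly`, PROVED AS A SKELETON.**  Data: the matrix `K_F` of the full covariant form on the
unit-lattice bond fields of `Λ_k` (curl part + `L^{d−2}`·average part), a quadratic partition of unity `{h_s}` subordinate to the doubled M-cubes with IMS
Schur letter `ε`; per cube `s`: the local small gauge `u_s` (an isometry carrying admissible fields to flat-admissible ones), the gauged form `F′_s` with
the covariance identity (cov) `⟨h_s·x, K_F(h_s·x)⟩ = F′_s(u_s(h_s·x))` on `good`, the FLAT form `F⁰_s` with the flat floor `c` on `good⁰_s` (B6 Lemma 2.4 —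
§7 BY VALUE) and the perturbation letter (pert) `F⁰_s Y∕2 − δ‖Y‖² ≤ F′_s Y` on `good⁰_s`; and `⟨x, K_F x⟩ ≤ F x` on `good` (on the admissible subspace
`Q₁(V)B = 0`, so the full form IS the curl form `F`).  Conclusion: `∀ x, good x → (c∕2 − δ − ε∕2)·(x ⬝ᵥ x) ≤ F x` — VERBATIM the hypothesis `h2` of
`B9SectEKernel.gamma0_assembly` with `c_V := c∕2 − δ − ε∕2` (SectE-interface-proof §5.6: `c_V = ½c(d,L) − c₄²ε_F² − ½ε_IMS`). [folklore] -/
theorem admissible_floor (KF : Matrix m m ℝ) (h : ι → m → ℝ) (hpart : ∀ i, ∑ s, h s i ^ 2 = 1) {ε : ℝ} (hε : 0 ≤ ε)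
    (hrow : ∀ i, ∑ j, |KF i j| * ∑ s, (h s i - h s j) ^ 2 ≤ ε)
    (hcol : ∀ j, ∑ i, |KF i j| * ∑ s, (h s i - h s j) ^ 2 ≤ ε)
    (good : (m → ℝ) → Prop) {c δ : ℝ}
    (u : ι → (m → ℝ) → (m' → ℝ)) (F' F0 : ι → (m' → ℝ) → ℝ) (good0 : ι → (m' → ℝ) → Prop)
    (hiso : ∀ s x, good x → u s (h s * x) ⬝ᵥ u s (h s * x) = (h s * x) ⬝ᵥ (h s * x))
    (hcov : ∀ s x, good x → (h s * x) ⬝ᵥ (KF *ᵥ (h s * x)) = F' s (u s (h s * x)))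
    (hadm : ∀ s x, good x → good0 s (u s (h s * x)))
    (hpert : ∀ s Y, good0 s Y → F0 s Y / 2 - δ * (Y ⬝ᵥ Y) ≤ F' s Y)
    (hflat : ∀ s Y, good0 s Y → c * (Y ⬝ᵥ Y) ≤ F0 s Y)
    (F : (m → ℝ) → ℝ) (hFK : ∀ x, good x → x ⬝ᵥ (KF *ᵥ x) ≤ F x) :
    ∀ x : m → ℝ, good x → (c / 2 - δ - ε / 2) * (x ⬝ᵥ x) ≤ F x := by
  intro x hx
  -- the local floors on the localised fields, cube by cube (Lemma 5.5's shape, with `X := h_s·x` read through `good x`)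
  have hloc : ∀ s x, good x → (c / 2 - δ) * ((h s * x) ⬝ᵥ (h s * x)) ≤ (h s * x) ⬝ᵥ (KF *ᵥ (h s * x)) := by
    intro s x hx
    rw [hcov s x hx, ← hiso s x hx]
    exact floor_of_half_sub (F0 s) (F' s) (good0 s) (hflat s) (hpert s) _ (hadm s x hx)
  have hK := floor_of_ims KF h hpart hε hrow hcol good hloc x hx
  linarith [hFK x hx]

end Admissible

/-! ## §5 `gamma0_assembly` BY NAME with (h2) supplied, and the sandwich `C*Δ_kC` -/

section Assembly

variable {n m m' : Type*} [Fintype n] [Fintype m] [DecidableEq m] [Fintype m'] {ι : Type*} [Fintype ι]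

/-- **PRINT's `γ₀′` WITH (h2) SUPPLIED.**  `B9SectEKernel.gamma0_assembly`'s data and hypotheses VERBATIM except `h2`, which is replaced by §4's data
(`K_F, h, ε, u_s, F′_s, F⁰_s, good⁰_s, δ, c` with their letters); conclusion `((c∕2 − δ − ε∕2 − κ₂)∕κ₁ − θ)‖B‖² ≤ ⟨B, (P − a − 𝒥)B⟩` for admissible `B`
— `Δ_k ≥ γ₀′` on the subspace of (3.156) with `c_V` a function of the four letters. [folklore] -/
theorem gamma0_assembly_of_ims (K : Matrix n n ℝ) (Q : Matrix m n ℝ) (a : ℝ) (H : Matrix n m ℝ) (P Jm : Matrix m m ℝ)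
    (hQH : Q * H = 1) (hSH : (K + a • (Qᵀ * Q)) * H = Qᵀ * P) (good : (m → ℝ) → Prop)
    (F : (m → ℝ) → ℝ) {κ₁ κ₂ θ : ℝ} (hκ₁ : 0 < κ₁)
    (h1 : ∀ A : n → ℝ, F (Q *ᵥ A) ≤ κ₁ * (A ⬝ᵥ (K *ᵥ A)) + κ₂ * ((Q *ᵥ A) ⬝ᵥ (Q *ᵥ A)))
    (hJ : ∀ B : m → ℝ, |B ⬝ᵥ (Jm *ᵥ B)| ≤ θ * (B ⬝ᵥ B))
    -- the (h2) data of §4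
    (KF : Matrix m m ℝ) (h : ι → m → ℝ) (hpart : ∀ i, ∑ s, h s i ^ 2 = 1) {ε : ℝ} (hε : 0 ≤ ε)
    (hrow : ∀ i, ∑ j, |KF i j| * ∑ s, (h s i - h s j) ^ 2 ≤ ε)
    (hcol : ∀ j, ∑ i, |KF i j| * ∑ s, (h s i - h s j) ^ 2 ≤ ε) {c δ : ℝ}
    (u : ι → (m → ℝ) → (m' → ℝ)) (F' F0 : ι → (m' → ℝ) → ℝ) (good0 : ι → (m' → ℝ) → Prop)
    (hiso : ∀ s x, good x → u s (h s * x) ⬝ᵥ u s (h s * x) = (h s * x) ⬝ᵥ (h s * x))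
    (hcov : ∀ s x, good x → (h s * x) ⬝ᵥ (KF *ᵥ (h s * x)) = F' s (u s (h s * x)))
    (hadm : ∀ s x, good x → good0 s (u s (h s * x)))
    (hpert : ∀ s Y, good0 s Y → F0 s Y / 2 - δ * (Y ⬝ᵥ Y) ≤ F' s Y)
    (hflat : ∀ s Y, good0 s Y → c * (Y ⬝ᵥ Y) ≤ F0 s Y)
    (hFK : ∀ x, good x → x ⬝ᵥ (KF *ᵥ x) ≤ F x)
    (B : m → ℝ) (hB : good B) :
    ((c / 2 - δ - ε / 2 - κ₂) / κ₁ - θ) * (B ⬝ᵥ B) ≤ B ⬝ᵥ ((P - a • (1 : Matrix m m ℝ) - Jm) *ᵥ B) :=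
  gamma0_assembly K Q a H P Jm hQH hSH good F hκ₁ h1
    (admissible_floor KF h hpart hε hrow hcol good u F' F0 good0 hiso hcov hadm hpert hflat F hFK) hJ B hB

/-- **… AND THE SANDWICH (3.157)–(3.158)** (`B9SectEKernel.coercive_sandwich_of_range` BY NAME): `C` maps reduced fields into the admissible subspace
and does not decrease norms, the floor is nonnegative ⊢ `QGQInverse.Coercive (Cᵀ(P − a − 𝒥)C) ((c∕2 − δ − ε∕2 − κ₂)∕κ₁ − θ)` — print's «`C*Δ_kC` … with
a lower bound `γ₀`» with (h2) supplied. [folklore] -/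
theorem coercive_sandwich_of_ims {p : Type*} [Fintype p]
    (K : Matrix n n ℝ) (Q : Matrix m n ℝ) (a : ℝ) (H : Matrix n m ℝ) (P Jm : Matrix m m ℝ)
    (hQH : Q * H = 1) (hSH : (K + a • (Qᵀ * Q)) * H = Qᵀ * P) (good : (m → ℝ) → Prop)
    (F : (m → ℝ) → ℝ) {κ₁ κ₂ θ : ℝ} (hκ₁ : 0 < κ₁)
    (h1 : ∀ A : n → ℝ, F (Q *ᵥ A) ≤ κ₁ * (A ⬝ᵥ (K *ᵥ A)) + κ₂ * ((Q *ᵥ A) ⬝ᵥ (Q *ᵥ A)))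
    (hJ : ∀ B : m → ℝ, |B ⬝ᵥ (Jm *ᵥ B)| ≤ θ * (B ⬝ᵥ B))
    (KF : Matrix m m ℝ) (h : ι → m → ℝ) (hpart : ∀ i, ∑ s, h s i ^ 2 = 1) {ε : ℝ} (hε : 0 ≤ ε)
    (hrow : ∀ i, ∑ j, |KF i j| * ∑ s, (h s i - h s j) ^ 2 ≤ ε)
    (hcol : ∀ j, ∑ i, |KF i j| * ∑ s, (h s i - h s j) ^ 2 ≤ ε) {c δ : ℝ}
    (u : ι → (m → ℝ) → (m' → ℝ)) (F' F0 : ι → (m' → ℝ) → ℝ) (good0 : ι → (m' → ℝ) → Prop)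
    (hiso : ∀ s x, good x → u s (h s * x) ⬝ᵥ u s (h s * x) = (h s * x) ⬝ᵥ (h s * x))
    (hcov : ∀ s x, good x → (h s * x) ⬝ᵥ (KF *ᵥ (h s * x)) = F' s (u s (h s * x)))
    (hadm : ∀ s x, good x → good0 s (u s (h s * x)))
    (hpert : ∀ s Y, good0 s Y → F0 s Y / 2 - δ * (Y ⬝ᵥ Y) ≤ F' s Y)
    (hflat : ∀ s Y, good0 s Y → c * (Y ⬝ᵥ Y) ≤ F0 s Y)
    (hFK : ∀ x, good x → x ⬝ᵥ (KF *ᵥ x) ≤ F x)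
    (C : Matrix m p ℝ) (hgood : ∀ v : p → ℝ, good (C *ᵥ v)) (hC : ∀ v : p → ℝ, v ⬝ᵥ v ≤ (C *ᵥ v) ⬝ᵥ (C *ᵥ v))
    (hγ : 0 ≤ (c / 2 - δ - ε / 2 - κ₂) / κ₁ - θ) :
    QGQInverse.Coercive (Cᵀ * (P - a • (1 : Matrix m m ℝ) - Jm) * C) ((c / 2 - δ - ε / 2 - κ₂) / κ₁ - θ) :=
  coercive_sandwich_of_range (P - a • (1 : Matrix m m ℝ) - Jm) C good hγ hgood hC
    (gamma0_assembly_of_ims K Q a H P Jm hQH hSH good F hκ₁ h1 hJ KF h hpart hε hrow hcol u F' F0 good0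
      hiso hcov hadm hpert hflat hFK)

end Assembly

/-! ## §6 Theorem E1's arithmetic: the constant `γ₀′ = c∕640` -/

section Value

/-- **THEOREM E1's ARITHMETIC** (SectE-interface-proof §5.8): if `0 ≤ c`, `0 < κ₁ ≤ 40`, `κ₂ ≤ c∕8`, `δ ≤ c∕8` (`c₄²ε_F² ≤ c∕8`), `ε ≤ c∕4`
(`M ≥ M₃`), `θ ≤ c∕640`, then `c∕640 ≤ (c∕2 − δ − ε∕2 − κ₂)∕κ₁ − θ` (`c_V ≥ c∕4`, `(c_V − κ₂)∕κ₁ ≥ c∕320`). [folklore] -/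
theorem gamma0_value_ge {c κ₁ κ₂ δ ε θ : ℝ} (hc : 0 ≤ c) (hκ₁ : 0 < κ₁) (hκ₁' : κ₁ ≤ 40)
    (hκ₂ : κ₂ ≤ c / 8) (hδ : δ ≤ c / 8) (hε : ε ≤ c / 4) (hθ : θ ≤ c / 640) :
    c / 640 ≤ (c / 2 - δ - ε / 2 - κ₂) / κ₁ - θ := by
  have hnum : c / 8 ≤ c / 2 - δ - ε / 2 - κ₂ := by linarith
  have hq : c / 320 ≤ (c / 2 - δ - ε / 2 - κ₂) / κ₁ := by
    rw [le_div_iff₀ hκ₁]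
    have : c / 320 * κ₁ ≤ c / 320 * 40 := mul_le_mul_of_nonneg_left hκ₁' (by positivity)
    linarith
  linarith

variable {n m m' : Type*} [Fintype n] [Fintype m] [DecidableEq m] [Fintype m'] {ι : Type*} [Fintype ι]

/-- **`C*Δ_kC ≥ γ₀ := c∕640`** — §5's sandwich under Theorem E1's smallness conditions on the letters (`0 ≤ c` makes the floor nonnegative for free).
With §7's flat constant this reads `γ₀ = κ₀(d,L)·L^{−(d+1)}∕(7680 d²)`. [folklore] -/
theorem coercive_sandwich_of_ims_value {p : Type*} [Fintype p]
    (K : Matrix n n ℝ) (Q : Matrix m n ℝ) (a : ℝ) (H : Matrix n m ℝ) (P Jm : Matrix m m ℝ)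
    (hQH : Q * H = 1) (hSH : (K + a • (Qᵀ * Q)) * H = Qᵀ * P) (good : (m → ℝ) → Prop)
    (F : (m → ℝ) → ℝ) {κ₁ κ₂ θ : ℝ} (hκ₁ : 0 < κ₁)
    (h1 : ∀ A : n → ℝ, F (Q *ᵥ A) ≤ κ₁ * (A ⬝ᵥ (K *ᵥ A)) + κ₂ * ((Q *ᵥ A) ⬝ᵥ (Q *ᵥ A)))
    (hJ : ∀ B : m → ℝ, |B ⬝ᵥ (Jm *ᵥ B)| ≤ θ * (B ⬝ᵥ B))
    (KF : Matrix m m ℝ) (h : ι → m → ℝ) (hpart : ∀ i, ∑ s, h s i ^ 2 = 1) {ε : ℝ} (hε : 0 ≤ ε)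
    (hrow : ∀ i, ∑ j, |KF i j| * ∑ s, (h s i - h s j) ^ 2 ≤ ε)
    (hcol : ∀ j, ∑ i, |KF i j| * ∑ s, (h s i - h s j) ^ 2 ≤ ε) {c δ : ℝ}
    (u : ι → (m → ℝ) → (m' → ℝ)) (F' F0 : ι → (m' → ℝ) → ℝ) (good0 : ι → (m' → ℝ) → Prop)
    (hiso : ∀ s x, good x → u s (h s * x) ⬝ᵥ u s (h s * x) = (h s * x) ⬝ᵥ (h s * x))
    (hcov : ∀ s x, good x → (h s * x) ⬝ᵥ (KF *ᵥ (h s * x)) = F' s (u s (h s * x)))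
    (hadm : ∀ s x, good x → good0 s (u s (h s * x)))
    (hpert : ∀ s Y, good0 s Y → F0 s Y / 2 - δ * (Y ⬝ᵥ Y) ≤ F' s Y)
    (hflat : ∀ s Y, good0 s Y → c * (Y ⬝ᵥ Y) ≤ F0 s Y)
    (hFK : ∀ x, good x → x ⬝ᵥ (KF *ᵥ x) ≤ F x)
    (C : Matrix m p ℝ) (hgood : ∀ v : p → ℝ, good (C *ᵥ v)) (hC : ∀ v : p → ℝ, v ⬝ᵥ v ≤ (C *ᵥ v) ⬝ᵥ (C *ᵥ v))
    (hc : 0 ≤ c) (hκ₁' : κ₁ ≤ 40) (hκ₂ : κ₂ ≤ c / 8) (hδ : δ ≤ c / 8) (hε' : ε ≤ c / 4) (hθ : θ ≤ c / 640) :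
    QGQInverse.Coercive (Cᵀ * (P - a • (1 : Matrix m m ℝ) - Jm) * C) (c / 640) := by
  have hval := gamma0_value_ge hc hκ₁ hκ₁' hκ₂ hδ hε' hθ
  have hco := coercive_sandwich_of_ims K Q a H P Jm hQH hSH good F hκ₁ h1 hJ KF h hpart hε hrow hcol u F' F0 good0
    hiso hcov hadm hpert hflat hFK C hgood hC ((by positivity : (0 : ℝ) ≤ c / 640).trans hval)
  intro v
  exact (mul_le_mul_of_nonneg_right hval (Literature.LinearAlgebra.Matrix.dotProduct_self_nonneg_real v)).trans (hco v)

end Value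

/-! ## §7 The flat slot BY VALUE: B6 Lemma 2.4 (PROVED in the tree) on the bond fields of `Λ = B(Λ′)`, and colour components -/

section Flat

open Literature.MathematicalPhysics.QuantumFieldTheory.Balaban1983to89.B6LayerPoincare (kappa0)
open Literature.MathematicalPhysics.QuantumFieldTheory.Balaban1983to89.B6BondElimination (treeBonds)
open Literature.MathematicalPhysics.QuantumFieldTheory.Balaban1983to89.B6Lemma24Carrier (lamBonds normSq q1Of d1Sq)
open Literature.MathematicalPhysics.QuantumFieldTheory.Balaban1983to89.B6Lemma24Assembly (lemma24_kappa0)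

variable {d L : ℕ}

/-- **THE FLAT FLOOR BY VALUE** ([B6] Lemma 2.4 (2.128) with the repaired layer constant, `B6Lemma24Assembly.lemma24_kappa0` BY NAME): for `d ≥ 2`,
`L ≥ 1`, `Λ′ ⊂ LZ^d` and every REAL bond field `Y` indexed by the bonds `lamBonds L Λ′` of `Λ = B(Λ′)` that vanishes on the tree-gauge bonds (2.121)
of every block, `κ₀(d,L)∕(12d²)·L^{−(d+1)}·(Y ⬝ᵥ Y) ≤ L^{d−2}·q1Of(Ỹ) + d1Sq(Ỹ)`, `Ỹ` = `Y` extended by zero to all unit bonds of `Z^d` — the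
`hflat` letter of §4 for ONE colour component on ONE cube region, with `c := κ₀(d,L)∕(12d²)·L^{−(d+1)}` a closed function of `d, L`. [folklore] -/
theorem flat_floor_lemma24 (hd : 2 ≤ d) (hL : 1 ≤ L) {Λ' : Finset (Fin d → ℤ)} (hΛ : ∀ y ∈ Λ', ∀ i, (L : ℤ) ∣ y i)
    (Y : ↥(lamBonds L Λ') → ℝ)
    (hT : ∀ y ∈ Λ', ∀ b : ↥(lamBonds L Λ'), (b : (Fin d → ℤ) × Fin d) ∈ treeBonds L y → Y b = 0) :
    kappa0 d L / (12 * (d : ℝ) ^ 2) * (L : ℝ) ^ (-((d : ℝ) + 1)) * (Y ⬝ᵥ Y) ≤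
      (L : ℝ) ^ ((d : ℝ) - 2) * q1Of L Λ' (fun b => if hb : b ∈ lamBonds L Λ' then Y ⟨b, hb⟩ else 0) +
        d1Sq L Λ' (fun b => if hb : b ∈ lamBonds L Λ' then Y ⟨b, hb⟩ else 0) := by
  set Yt : (Fin d → ℤ) × Fin d → ℝ := fun b => if hb : b ∈ lamBonds L Λ' then Y ⟨b, hb⟩ else 0 with hYt
  have hB0 : ∀ b, b ∉ lamBonds L Λ' → Yt b = 0 := fun b hb => by simp only [hYt, dif_neg hb]
  have hTt : ∀ y ∈ Λ', ∀ b ∈ treeBonds L y, Yt b = 0 := by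
    intro y hy b hb
    by_cases hbl : b ∈ lamBonds L Λ'
    · simp only [hYt, dif_pos hbl]; exact hT y hy ⟨b, hbl⟩ hb
    · exact hB0 b hbl
  have hmain := lemma24_kappa0 hd hL hΛ Yt hB0 hTt
  have hnorm : normSq L Λ' Yt = Y ⬝ᵥ Y := by
    rw [normSq, ← Finset.sum_coe_sort]
    simp only [dotProduct]
    refine Finset.sum_congr rfl fun b _ => ?_
    simp only [hYt, dif_pos b.2, pow_two]
  rwa [hnorm] at hmain

variable {m κ : Type*} [Fintype m] [Fintype κ]

/-- **COLOUR COMPONENTS ADD**: a floor with the same `c` for every component functional `F⁰_a` on the component `Y(·, a)` of an `m × κ`-indexed field is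
a floor `c` for `Σ_a F⁰_a(Y(·,a))` on the whole field (`‖Y‖² = Σ_a ‖Y(·,a)‖²`) — how §7's scalar Lemma 2.4 serves `𝔤 ≅ ℝ^κ`-valued fields at `U = 1`
(flat curl and flat average act componentwise). [folklore] -/
theorem floor_of_components (F0c : κ → (m → ℝ) → ℝ) (goodc : κ → (m → ℝ) → Prop) {c : ℝ}
    (hc : ∀ a Z, goodc a Z → c * (Z ⬝ᵥ Z) ≤ F0c a Z) (Y : m × κ → ℝ) (hY : ∀ a, goodc a fun i => Y (i, a)) :
    c * (Y ⬝ᵥ Y) ≤ ∑ a, F0c a fun i => Y (i, a) := by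
  have e : Y ⬝ᵥ Y = ∑ a, (fun i => Y (i, a)) ⬝ᵥ (fun i => Y (i, a)) := by
    simp only [dotProduct]
    rw [Fintype.sum_prod_type, Finset.sum_comm]
  rw [e, Finset.mul_sum]
  exact Finset.sum_le_sum fun a _ => hc a _ (hY a)

end Flat

/-! ## §8 Toy: one cube, trivial gauge — the only loss is Lemma 5.5's structural `½` -/

section Toy

/- One cube (`ι = Unit`, `h ≡ 1`), `u = id`, `K_F = 1`, `F′ = F⁰ = F = ‖·‖²`, `c = 1`, `δ = ε = 0`: §4 gives `½‖x‖² ≤ ‖x‖²`. -/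
example (x : Fin 2 → ℝ) : (1 / 2 - 0 - 0 / 2) * (x ⬝ᵥ x) ≤ x ⬝ᵥ x :=
  admissible_floor (ι := Unit) (1 : Matrix (Fin 2) (Fin 2) ℝ) (fun _ _ => (1 : ℝ))
    (fun _ => by simp) (ε := 0) le_rfl (fun _ => by simp) (fun _ => by simp) (fun _ => True) (c := 1) (δ := 0)
    (fun _ X => X) (fun _ Y => Y ⬝ᵥ Y) (fun _ Y => Y ⬝ᵥ Y) (fun _ _ => True)
    (fun _ _ _ => rfl) (fun _ y _ => by simp only [Matrix.one_mulVec]) (fun _ _ _ => trivial)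
    (fun _ Y _ => by
      simp only [zero_mul, sub_zero]
      linarith [Literature.LinearAlgebra.Matrix.dotProduct_self_nonneg_real Y])
    (fun _ Y _ => (one_mul _).le) (fun y => y ⬝ᵥ y) (fun y _ => by rw [Matrix.one_mulVec]) x trivial

end Toy

end Summit.QuantumFields.BalabanUV.T4Continuum.NE7b.AdmissibleFloorIMS

end
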